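import Summits.BirchSwinnertonDyer.Rank1Residual.ManinAdditive.KummerCubeMonodromy
import Summits.BirchSwinnertonDyer.BirchSwinnertonDyer.Theorems.ManinLocalTwoThreeKummerCubeSigmaLeaves
import HarnessLib
import HarnessLib.Audit.Tags

/-!
# The UDC line for the reducible residual of C3 (cell bsd-f2-manin, -an g37, MEMO-an §80.12; nothing asserted)

TYPER NOTE (typer g20, T-an-43 PART 1).  SOURCE = HOME/an/g37/UDCKummerLine-an-g37.lean sha16 d0d0282e54f69dca (215 l.; an: farm rc 0 · 0 err ·
0 warn · 0 s∗rry; BC7 6/6 CLEAN g37-bc7-udc.out 1e269a611ec3ac0a) VERBATIM except this note.  LITERATURE STATUS of the two cite-shaped inputs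
(searched before filing, D-0026): (1) the Unbounded Denominators theorem is ALREADY VENDORED in the tree as the named fact
`Literature.NumberTheory.Automorphic.CalegariDimitrovTang2025_unboundedDenominators` (+ `_algInt`; `Literature/NumberTheory/Automorphic/UnboundedDenominators.lean`,
HOLOMORPHIC-at-the-cusps rendering over Mathlib's bundled `ModularForm Γ k` with integral `qExpansion h`, any width `h`; companions
`UnboundedDenominatorsGammaInvariance.lean` (conclusion ⟺ `Γ(N)`-slash-invariance) and `UnboundedDenominatorsProofs.lean` / `WohlfahrtTheorem.lean`
with WOHLFAHRT'S THEOREM PROVED: `Gamma_le_of_isCongruenceSubgroup_of_forall_conj_T_pow_mem`).  an's `UnboundedDenominatorsWeight k` below is a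
DIFFERENT special case of the same printed Theorem 1.0.1 (unbundled `F`, MEROMORPHIC at the cusps via exponential growth of every slash, width-one
integer `q`-expansion) — implied by the print, NOT by the tree's holomorphic rendering; it stays here as an's Summits-side cite-shaped `def` (no second
Literature copy is minted).  If (AN♮) can be run with a bounded-at-the-cusps `F` (raise the power of `Δ`), the cite input should be re-pointed at the
tree fact by name.  (2) Kurth–Long 2008 Prop. 18 (`TypeIINoncongruence`, an's `Γ₀`/`SL₂`-with-`±I` rendering, re-read by the typer on the
materialised text p. 1997: Def. 16, Lemma 17, Prop. 18 VERBATIM as quoted) is PROVABLE from the tree's Wohlfahrt theorem (congruence + all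
parabolics of `Γ₀(n)` ⟹ `Γ(n) ≤ Γ` ⟹ with `T ∈ Γ`: `Γ₁(n) ≤ Γ`); the typer lands that discharge as a Literature THEOREM + a `…Holds` sibling
(`typeIINoncongruence_holds`) right after this leaf.  IMPORT NOTE: an's `Theorems.ManinLocalTwoThreeKummerCubeSigmaLeaves` import (for S6 in the
proved composition) has a Theses-FREE cone (106 Summits modules, 0 `Theses`, checked by the typer) — route-independent, kept verbatim.  `@[conjecture]`
rows: (NC) `KummerCoverNoncongruence`, (BI) `KummerCubeRootThreeBounded`, (AN) `KummerCubeRootCongruenceOfBounded`, restub pieces (NC-a)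
`KummerCoverSubgroup`, (NC-b) `KummerCoverNotGammaOne`, (AN♮) `KummerCubeRootCongruenceOfBoundedOfUDC`; plain defs `KummerPeriodTrivial`,
`IsThreeAdicallyBounded`, `UnboundedDenominatorsWeight`, `TypeIINoncongruence`, `ReducibleCaseAtNine`; PROVED `reducibleCaseAtNine_of_udc`.
PART 2 (`Theorems/ManinLocalTwoThreeUDCKummerLineC3.lean`, C3 composition) is prover-only → p2/p3.  Refuter verdict R-an-73 pending at landing time.
bears_on stmt-BirchSwinnertonDyer-22968 (C3 reducible residual).  BSD is not proved by this; C3 OPEN.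

**Thesis.** For an OPTIMAL `E/ℚ` (`Λ_E = c·Λ_f`) with a rational point `T` of order `3` (any `N`; C3 needs `9 ∣ N`):
`3 ∤ c_E`.  The Kummer branch of `kato_shift_three` (stubs E-an-57 + LAW₃♮ → NB₃) is replaced by three
statements each of which is a printed theorem plus kernel bookkeeping:

* (NC) `KummerCoverNoncongruence` — the index-3 étale Kummer cover `Y_T → X₀(N)` cut out by `∛(f_T∘φ)`, i.e.
  `Γ_T = {γ ∈ Γ₀(N) : c{∞,γ∞}_f ∈ ℤ·3a + 3Λ}` (S4), contains NO principal congruence subgroup.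
  Proof on paper: parabolics have zero cusp symbol (tree `cuspSymbol_eq_zero_of_isParabolic`), so `χ_T` is of
  type II; `Γ_T ⊉ Γ₁(N)` because otherwise `Y_T` is a quotient of `X₁(N)`, so `φ^*T ∈ Σ(N) = ker(J₀(N) → J₁(N))`,
  which is of multiplicative type [Ling–Oesterlé 1991; Vatsal 2005 p.1 VERBATIM «It is known that V is of multiplicative
  type, meaning that the Cartier dual W = Hom(V, 𝔾_m) is trivial for the action of Galois»], hence has no rational point
  of odd order > 1 — contradiction with `φ^*` injective (optimality) and `T` rational of order 3; then
  [Kurth–Long 2008, Prop. 18 VERBATIM «Let ϕ be a homomorphism of type II from Γ⁰(n) to another finite group (not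
  necessarily abelian) whose kernel Γ does not contain Γ¹(n). Then Γ is noncongruence.»] (conjugate by `[0,1;−1,0]`).
* (BI) `KummerCubeRootThreeBounded` — `3 ∣ c ⇒` the normalised formal cube root `h` (`h³ = Θ_T`, `h(0) = −1`) of the
  tree's Kummer series is `3`-adically bounded.  Proof on paper: E-an-55 `ManinThreeKummerCube` (THEOREM, p623988) gives
  `Θ·B³ = A³` in `ℤ₃⟦q⟧`; `μ₃(ℚ₃((q))) = 1` forces `A/B = h`; `ℤ₃⟦q⟧` is factorial (Weierstrass preparation), hence
  integrally closed, and `(3^K h)³ ∈ ℤ₃⟦q⟧` gives `3^K h ∈ ℤ₃⟦q⟧`.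
* (AN) `KummerCubeRootCongruenceOfBounded` — if `h` is `3`-adically bounded then `Γ_T ⊇ Γ₀(N) ∩ Γ(M)` for some `M`.
  Proof on paper: `h^{min} := ρ⁻¹h` (`ρ = c·t_s/z_W ∈ ℚ(E)`, `ρ(O) = 1`) is the cube root of the MINIMAL-model Kummer
  series `z_W³(y − y_T − λ(x − x_T)) ∈ −1 + qℤ⟦q⟧` (Honda: `z_W = [c]u(q) ∈ ℤ⟦q⟧`), so `h^{min} ∈ ℤ[1/3]⟦q⟧`, and with (BI)
  `D·h^{min} ∈ ℤ⟦q⟧`; analytically (tree S1/S3/S3′) `h = κ·t_s·W_a(cE_f)` is meromorphic on `ℍ` with poles exactly on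
  `φ⁻¹(E[2]∖O)` (order = ramification index `≤ e`), `h∘γ = ζ₃^{χ_T(γ)}·h`; with `P(X) = ∏_{P ∈ φ⁻¹(E[2]∖O)}(X − j(P)) ∈ ℚ[X]`
  the function `F = D′·h^{min}·P(j)^e·Δ^k` is holomorphic on `ℍ`, of weight `12k` for `Γ_T`, meromorphic at the cusps, with
  `F ∈ ℤ⟦q⟧`; the Unbounded Denominators theorem [Calegari–Dimitrov–Tang, JAMS 38 (2025), Thm. 1.0.1 VERBATIM «Let N be any
  positive integer, and let f(τ) ∈ ℤ⟦q^{1/N}⟧ for q = exp(πiτ) be a holomorphic function on the upper half plane. Suppose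
  there exists an integer k and a finite index subgroup Γ ⊂ SL₂(ℤ) such that f((aτ+b)/(cτ+d)) = (cτ+d)^k f(τ) ∀ γ ∈ Γ, and
  suppose that f(τ) is meromorphic at the cusps … Then f(τ) is a modular form for a congruence subgroup of SL₂(ℤ).»] makes
  `F`, hence `h = F/(D′ρ⁻¹P(j)^eΔ^k)`, invariant under some `Γ(M)`, i.e. `χ_T = 0` on `Γ₀(N) ∩ Γ(M)`.

`reducibleCaseAtNine_of_udc : NC → BI → AN → ReducibleCaseAtNine` is PROVED below (pure logic + tree S6
`shortThreeTorsionLift`).  27a1 sanity (c = 1): `v₃(h_k)` = 0,0,0,−1,−1,−1,−2,…,−10 at `k = 24` (unbounded, file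
udc-27a1-an-g37.out) and `Γ_{T}` is noncongruence: `q = (−1916, 6237; −1485, 4834) ∈ Γ(27)` has `χ_T(q) = 1`
(psi27-noncongruence-27a1-an-g37.out).  PARTITION 0 new data · beyond-print theorem: YES (the implication
«optimal + rational 3-torsion ⇒ 3 ∤ c» is not in print: ARS 2006 §2 list, Česnavičius 2018, CNS 2022 do not cover
additive `3`) · BSD is not proved by this.
-/

open PowerSeries CongruenceSubgroup Complex
open scoped MatrixGroups ModularForm PeriodPair UpperHalfPlane Manifold
open WeierstrassCurve Literature.NumberTheory.EllipticCurves Literature.NumberTheory.EllipticCurves.ModularForms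
open Summit.BirchSwinnertonDyer.Rank1Residual.ManinAdditive.CuspidalKummer
open Summit.BirchSwinnertonDyer.Rank1Residual.ManinAdditive.CuspidalKummerThree
open Summit.BirchSwinnertonDyer.Rank1Residual.ManinAdditive.KummerCubeMonodromy

namespace Summit.BirchSwinnertonDyer.Rank1Residual.ManinAdditive.UDCKummerLine

section Defs

variable {W : WeierstrassCurve ℚ} [W.IsElliptic] {N : ℕ} [NeZero N]

/-- `χ_T(γ) = 0`: the scaled period `c·{∞,γ∞}_f` lies in `ℤ·3a + 3Λ` (by S4 this is exactly «the `σ`-cube root of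
`Θ_T` has no monodromy along `γ`», i.e. `γ ∈ Γ_T`). [folklore] -/
def KummerPeriodTrivial (D : ModularParametrizationData W N) (a : ℂ) (γ : Gamma0 N) : Prop :=
  ∃ k : ℤ, ∃ ν ∈ D.L.lattice, (D.c : ℂ) * cuspSymbol D.f γ = k * (3 * a) + 3 * ν

/-- `h ∈ ℚ⟦q⟧` is `3`-adically bounded: `3^K·h ∈ ℤ₍₃₎⟦q⟧` for some `K`. [folklore] -/
def IsThreeAdicallyBounded (h : ℚ⟦X⟧) : Prop :=
  ∃ K : ℕ, ∀ n : ℕ, ¬ (3 ∣ ((3 : ℚ) ^ K * coeff n h).den)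

end Defs

/-- **Printed input 1 (statement shape only; used INSIDE the proof of (AN), never as a route hypothesis): the
Unbounded Denominators theorem, weight-`k`, width-`1` instance.**  A holomorphic `F : ℍ → ℂ` of weight `k` for a
finite-index `Γ ≤ SL₂(ℤ)`, of at most exponential growth at every cusp (⇔ meromorphic at the cusps), whose
`q`-expansion at `i∞` has integer coefficients, is invariant under some principal congruence subgroup.
[cite: CalegariDimitrovTang2025, Thm. 1.0.1 (VERBATIM «Let N be any positive integer, and let f(τ) ∈ ℤ⟦q^{1/N}⟧ for
q = exp(πiτ) be a holomorphic function on the upper half plane. Suppose there exists an integer k and a finite index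
subgroup Γ ⊂ SL₂(ℤ) such that f((aτ+b)/(cτ+d)) = (cτ+d)^k f(τ) for all (a b; c d) ∈ Γ, and suppose that f(τ) is
meromorphic at the cusps, that is, locally extends to a meromorphic function near every cusp in the compactification
of H/Γ. Then f(τ) is a modular form for a congruence subgroup of SL₂(ℤ).»; JAMS 38 (2025) 627–702,
doi:10.1090/jams/1053, arXiv:2109.09040; [corpus:paper:galaxy-pdf-7644864917620044500 p2–3])] -/
def UnboundedDenominatorsWeight (k : ℤ) : Prop :=
  ∀ (Γ : Subgroup SL(2, ℤ)), Γ.FiniteIndex → ∀ F : ℍ → ℂ, MDifferentiable 𝓘(ℂ) 𝓘(ℂ) F →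
    (∀ γ ∈ Γ, F ∣[k] γ = F) →
    (∀ g : SL(2, ℤ), ∃ C A m : ℝ, ∀ τ : ℍ, A ≤ τ.im → ‖(F ∣[k] g) τ‖ ≤ C * Real.exp (m * τ.im)) →
    (∃ b : ℕ → ℤ, ∀ τ : ℍ,
      HasSum (fun n : ℕ => (b n : ℂ) * Complex.exp (2 * Real.pi * Complex.I * (τ : ℂ) * n)) (F τ)) →
    ∃ M : ℕ, 0 < M ∧ ∀ γ ∈ CongruenceSubgroup.Gamma M, F ∣[k] γ = F

/-- **Printed input 2 (statement shape; pure group theory, used INSIDE the proof of (NC)): type II character groups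
of `Γ₀(n)` not containing `Γ₁(n)` are noncongruence.**  [cite: KurthLong2008, Prop. 18 (VERBATIM «Let ϕ be a
homomorphism of type II from Γ⁰(n) to another finite group (not necessarily abelian) whose kernel Γ does not contain
Γ¹(n). Then Γ is noncongruence.»; J. Number Theory 128 (2008) 1989–2009, doi:10.1016/j.jnt.2007.10.007; type II =
«sends all parabolic elements in Γ⁰ to the identity» (Def. 16); conjugation by `[0,1;−1,0] ∈ SL₂(ℤ)` carries
`Γ⁰(n), Γ¹(n)` to `Γ₀(n), Γ₁(n)`; the proof uses Wohlfahrt's level theorem [Woh64]).  Here typed with the slightly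
stronger hypothesis «every element of trace ±2 of Γ₀(n) lies in Γ» (parabolics and ±I).] -/
def TypeIINoncongruence : Prop :=
  ∀ (n : ℕ), 0 < n → ∀ Γ : Subgroup SL(2, ℤ), Γ.FiniteIndex → Γ ≤ Gamma0 n →
    (∀ g ∈ Gamma0 n, ∀ γ ∈ Γ, g * γ * g⁻¹ ∈ Γ) →
    (∀ γ ∈ Gamma0 n, (γ 0 0 + γ 1 1 = 2 ∨ γ 0 0 + γ 1 1 = -2) → γ ∈ Γ) →
    ¬ (Gamma1 n ≤ Γ) → ∀ M : ℕ, 0 < M → ¬ (CongruenceSubgroup.Gamma M ≤ Γ)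

/-- **(NC) `KummerCoverNoncongruence` (crux-sized; beyond print as stated, printed engines KL08 Prop. 18 + LO91).**
For an optimal datum (`Λ_E ⊆ c·Λ_f`), a rational `3`-torsion point `(X₀, Y₀)` of the short model and a lift `a`
(`a ∉ Λ`, `3a ∈ Λ`, `(c²℘(a), c³℘'(a)/2) = (X₀, Y₀)`), the Kummer character `χ_T` is non-zero on `Γ₀(N) ∩ Γ(M)`
for EVERY `M ≥ 1`: the étale triple cover `Y_T → X₀(N)` is noncongruence.  Why it might fail: only if `φ^*T` could
lie in the Shimura subgroup (excluded: `Σ(N)` is of `μ`-type, `T` rational of odd order, `φ^*` injective) — i.e. not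
at all on paper; Lean cost is the `J₀(N)`-free reformulation (diamond operators / `Γ₁(N)`-periods, tree
`cuspSymbol_mem_periodLatticeGamma1`).  27a1: `χ_{T₀}((−1916, 6237; −1485, 4834)) = 1` with that matrix in `Γ(27)`.
[cite: KurthLong2008, Prop. 18 (engine; VERBATIM above)] -/
@[conjecture]
def KummerCoverNoncongruence : Prop :=
  ∀ (W : WeierstrassCurve ℚ) [W.IsElliptic] [W.IsGloballyMinimal] {N : ℕ} [NeZero N]
    (D : ModularParametrizationData W N),
    (∀ z ∈ D.L.lattice, ∃ w ∈ periodLattice D.f, z = D.c * w) →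
    ∀ X₀ Y₀ : ℚ, IsShortThreeTorsion W D.c X₀ Y₀ →
    ∀ a : ℂ, a ∉ D.L.lattice → 3 * a ∈ D.L.lattice →
    (D.c : ℂ) ^ 2 * ℘[D.L] a = (X₀ : ℂ) → (D.c : ℂ) ^ 3 * ℘'[D.L] a / 2 = (Y₀ : ℂ) →
    ∀ M : ℕ, 0 < M → ∃ γ : Gamma0 N, (γ : SL(2, ℤ)) ∈ CongruenceSubgroup.Gamma M ∧ ¬ KummerPeriodTrivial D a γ

/-- **(BI) `KummerCubeRootThreeBounded` (support-sized; E-an-55 + normality of `ℤ₃⟦q⟧`).**  If `3 ∣ c` (and `9 ∣ N`,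
so that `a_{3m} = 0` and Honda applies as in E-an-55) the tangent-line Kummer series has a normalised formal cube root
`h` (`h³ = Θ_T`, `h(0) = −1`) with `3^K·h ∈ ℤ₍₃₎⟦q⟧`.  Why it might fail: it cannot on paper (E-an-55 is a theorem;
`Frac ℤ₃⟦q⟧ ∩ {h : h³ bounded}` is bounded by unique factorisation in `ℤ₃⟦q⟧` and `μ₃(ℚ₃((q))) = 1`); Lean cost:
Weierstrass preparation / integral closedness of `ℤ_[3]⟦X⟧` is not in Mathlib. [cite: Washington1997, Thm. 7.3 and
§7.1 (ℤ_p⟦T⟧ is a UFD via the Weierstrass preparation theorem; shape)] -/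
@[conjecture]
def KummerCubeRootThreeBounded : Prop :=
  ∀ (W : WeierstrassCurve ℚ) [W.IsElliptic] [W.IsGloballyMinimal] {N : ℕ} [NeZero N]
    (D : ModularParametrizationData W N) (a : ℕ → ℤ), (∀ n, (a n : ℂ) = cuspCoeff D.f n) →
    9 ∣ N → ∀ X₀ Y₀ : ℚ, IsShortThreeTorsion W D.c X₀ Y₀ →
    ∀ z : ℚ⟦X⟧, IsParamGerm W D.c a z → (3 : ℤ) ∣ D.c →
    ∃ h : ℚ⟦X⟧, h ^ 3 = kummerCubeSeries W D.c X₀ Y₀ z ∧ constantCoeff h = -1 ∧ IsThreeAdicallyBounded h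

/-- **(AN) `KummerCubeRootCongruenceOfBounded` (crux-sized; engine = the Unbounded Denominators theorem).**  For an
optimal datum, a rational `3`-torsion point with lift `a`, the germ `z` and a normalised formal cube root `h` of
`Θ_T`: if `h` is `3`-adically bounded then `χ_T` vanishes on `Γ₀(N) ∩ Γ(M)` for some `M ≥ 1`.  Why it might fail:
not on paper given CDT Thm 1.0.1 (the passage `h ↦ F = D′ρ⁻¹hP(j)^eΔ^k ∈ ℤ⟦q⟧`, holomorphic, weight `12k`, meromorphic
at cusps, uses Honda integrality of the minimal germ, `j(P)` algebraic for `P ∈ φ⁻¹(E[2])`, and tree S1/S2/S3/S3′);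
Lean cost is high (UDC itself is a 76-page theorem — to be a cite-tagged Literature fact).  On data the hypothesis is
never met (no optimal curve with `3 ∣ c` is known; 27a1 has `v₃(h_{24}) = −10`). [cite: CalegariDimitrovTang2025,
Thm. 1.0.1 (engine; VERBATIM above)] -/
@[conjecture]
def KummerCubeRootCongruenceOfBounded : Prop :=
  ∀ (W : WeierstrassCurve ℚ) [W.IsElliptic] [W.IsGloballyMinimal] {N : ℕ} [NeZero N]
    (D : ModularParametrizationData W N) (a : ℕ → ℤ), (∀ n, (a n : ℂ) = cuspCoeff D.f n) →
    (∀ z ∈ D.L.lattice, ∃ w ∈ periodLattice D.f, z = D.c * w) →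
    ∀ X₀ Y₀ : ℚ, IsShortThreeTorsion W D.c X₀ Y₀ →
    ∀ u : ℂ, u ∉ D.L.lattice → 3 * u ∈ D.L.lattice →
    (D.c : ℂ) ^ 2 * ℘[D.L] u = (X₀ : ℂ) → (D.c : ℂ) ^ 3 * ℘'[D.L] u / 2 = (Y₀ : ℂ) →
    ∀ z : ℚ⟦X⟧, IsParamGerm W D.c a z →
    ∀ h : ℚ⟦X⟧, h ^ 3 = kummerCubeSeries W D.c X₀ Y₀ z → constantCoeff h = -1 → IsThreeAdicallyBounded h →
    ∃ M : ℕ, 0 < M ∧ ∀ γ : Gamma0 N, (γ : SL(2, ℤ)) ∈ CongruenceSubgroup.Gamma M → KummerPeriodTrivial D u γ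

/-- **The reducible residual of C3 in E-an-55's binders:** an optimal curve with `9 ∣ N` and a rational point of
order `3` has `3 ∤ c`. (Target of the branch; with E-an-55's `∀ z` binder.) [folklore] -/
def ReducibleCaseAtNine : Prop :=
  ∀ (W : WeierstrassCurve ℚ) [W.IsElliptic] [W.IsGloballyMinimal] {N : ℕ} [NeZero N]
    (D : ModularParametrizationData W N) (a : ℕ → ℤ), (∀ n, (a n : ℂ) = cuspCoeff D.f n) → 9 ∣ N →
    (∀ z ∈ D.L.lattice, ∃ w ∈ periodLattice D.f, z = D.c * w) →
    ∀ X₀ Y₀ : ℚ, IsShortThreeTorsion W D.c X₀ Y₀ → ∀ z : ℚ⟦X⟧, IsParamGerm W D.c a z → ¬ (3 : ℤ) ∣ D.c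

open Summit.BirchSwinnertonDyer.BirchSwinnertonDyer.Theorems.ManinLocalTwoThree.KummerCubeSigmaLeaves in
/-- **Assembly (PROVED): (NC) ∧ (BI) ∧ (AN) ⇒ the reducible residual of C3.**  Pure logic plus tree S6
`shortThreeTorsionLift` (the analytic lift `u` of the rational `3`-torsion point). [folklore] -/
theorem reducibleCaseAtNine_of_udc (hNC : KummerCoverNoncongruence) (hBI : KummerCubeRootThreeBounded)
    (hAN : KummerCubeRootCongruenceOfBounded) : ReducibleCaseAtNine := by
  intro W _ _ N _ D a ha h9 hopt X₀ Y₀ hT z hz h3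
  obtain ⟨-, u, hu₁, hu₂, -, hX, hY⟩ := shortThreeTorsionLift W D X₀ Y₀ hT
  obtain ⟨h, hh3, hh0, hK⟩ := hBI W D a ha h9 X₀ Y₀ hT z hz h3
  obtain ⟨M, hM, hcong⟩ := hAN W D a ha hopt X₀ Y₀ hT u hu₁ hu₂ hX hY z hz h hh3 hh0 hK
  obtain ⟨γ, hγ, hne⟩ := hNC W D hopt X₀ Y₀ hT u hu₁ hu₂ hX hY M hM
  exact hne (hcong γ hγ)

/-! ### Restub shape of record (director 2026-08-29T12:57:06Z): print facts go to ONE cite stub; content stubs separately.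
(NC) = cite `TypeIINoncongruence` [KL08 Prop. 18] + content `KummerCoverSubgroup` (kernel: `cuspSymbol_mul_holds`,
`cuspSymbol_eq_zero_of_isParabolic`, index `≤ 3`) + content `KummerCoverNotGammaOne` (engine LO91; beyond print as stated)
+ glue `Γ(lcm(M,N)) ≤ Γ₀(N) ∩ Γ(M)` (M-size).  (AN) = cite `UnboundedDenominatorsWeight` [CDT25 Thm. 1.0.1] + content
`KummerCubeRootCongruenceOfBoundedOfUDC`.  (BI) = content. -/

/-- **(NC-a) `KummerCoverSubgroup` (content, kernel-provable, M): `Γ_T` is a finite-index subgroup of `Γ₀(N)`, normal,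
containing every element of trace `±2`** (`χ_T` is a homomorphism by `cuspSymbol_mul_holds` and S4; parabolics have zero
cusp symbol, `cuspSymbol_eq_zero_of_isParabolic`; `−I ↦ 0` by definition of `cuspSymbol`; index `≤ 3`).  Why it might
fail: it cannot (bookkeeping). [folklore] -/
@[conjecture]
def KummerCoverSubgroup : Prop :=
  ∀ (W : WeierstrassCurve ℚ) [W.IsElliptic] [W.IsGloballyMinimal] {N : ℕ} [NeZero N]
    (D : ModularParametrizationData W N),
    (∀ z ∈ D.L.lattice, ∃ w ∈ periodLattice D.f, z = D.c * w) →
    ∀ u : ℂ, u ∉ D.L.lattice → 3 * u ∈ D.L.lattice →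
    ∃ Γ : Subgroup SL(2, ℤ), (∀ γ : Gamma0 N, (γ : SL(2, ℤ)) ∈ Γ ↔ KummerPeriodTrivial D u γ) ∧
      Γ ≤ Gamma0 N ∧ Γ.FiniteIndex ∧ (∀ g ∈ Gamma0 N, ∀ γ ∈ Γ, g * γ * g⁻¹ ∈ Γ) ∧
      (∀ γ ∈ Gamma0 N, (γ 0 0 + γ 1 1 = 2 ∨ γ 0 0 + γ 1 1 = -2) → γ ∈ Γ)

/-- **(NC-b) `KummerCoverNotGammaOne` (content; printed engine, beyond print as stated): `Γ_T ⊉ Γ₁(N)`** — some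
`γ ∈ Γ₁(N)` has `c·{∞,γ∞}_f ∉ ℤ·3u + 3Λ`.  On paper: otherwise `Y_T` is a quotient of `X₁(N)` and `φ^*T ∈ Σ(N)`, a
`μ`-type group [LO91], which has no rational point of order `3`; `φ^*` is injective for the optimal curve.  Why it might
fail: not on paper; the Lean statement is `J₀(N)`-free and its kernel proof would need the `Γ₁(N)`-period lattice
(tree `cuspSymbol_mem_periodLatticeGamma1`, `ManinConstantGamma1ModularDegree`) and Stevens' `X₁(N)`-parametrisation.
[cite: Vatsal2005, §1 p.1 (VERBATIM «It is known that V is of multiplicative type, meaning that the Cartier dual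
W = Hom(V, 𝔾_m) is trivial for the action of Galois», V = ker(J₀(N) → J₁(N)), citing [LO91]; engine only)] -/
@[conjecture]
def KummerCoverNotGammaOne : Prop :=
  ∀ (W : WeierstrassCurve ℚ) [W.IsElliptic] [W.IsGloballyMinimal] {N : ℕ} [NeZero N]
    (D : ModularParametrizationData W N),
    (∀ z ∈ D.L.lattice, ∃ w ∈ periodLattice D.f, z = D.c * w) →
    ∀ X₀ Y₀ : ℚ, IsShortThreeTorsion W D.c X₀ Y₀ →
    ∀ u : ℂ, u ∉ D.L.lattice → 3 * u ∈ D.L.lattice →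
    (D.c : ℂ) ^ 2 * ℘[D.L] u = (X₀ : ℂ) → (D.c : ℂ) ^ 3 * ℘'[D.L] u / 2 = (Y₀ : ℂ) →
    ∃ γ : Gamma0 N, (γ : SL(2, ℤ)) ∈ Gamma1 N ∧ ¬ KummerPeriodTrivial D u γ

/-- **(AN♮) content half of (AN): the Unbounded Denominators theorem (all weights) implies (AN).** [folklore] -/
@[conjecture]
def KummerCubeRootCongruenceOfBoundedOfUDC : Prop :=
  (∀ k : ℤ, UnboundedDenominatorsWeight k) → KummerCubeRootCongruenceOfBounded

end Summit.BirchSwinnertonDyer.Rank1Residual.ManinAdditive.UDCKummerLine
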